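import Summits.QuantumFields.BalabanUV.T4Continuum.Support.NE7HintOfUhlenbeckChartSU2Dec
import Summits.QuantumFields.BalabanUV.T4Continuum.Support.NE7PairResidualSupRep
import Summits.QuantumFields.BalabanUV.T4Continuum.Support.AveragingDeficitMultiLevelBridge
import HarnessLib

/-!
# GEN 95 END OF RECORD (`…Dec`): F324 RE-ISSUED OVER THE HONEST PER-PAIR BINDER — `hint_SU2_of_decomposition`: (8)∃ ⇐ ONE k-free line ∧ `hdecomp♭`, where `hdecomp♭` asks,
# for every admissible pair with gen 94's residual near-representative `u₀` SUPPLIED, a unitary gauge `u` and a decomposition `U′^{u} = U_s·e^{X}`, `X = X_T + X_N`, `X_T ∈ T_♮(U_s)`,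
# with `‖X_N‖_w ≤ ν‖X‖_w`, `(ε∕M²)Σ‖curl X_N‖ ≤ κ‖X‖_w²`, `sup‖X‖·M ≤ α̂`, `ν ≤ ν̂`, `κ ≤ κ̂` (the weight currency of `hleaves♭` — numerically refuted for arbitrary pairs, memo
# `t4/b2b-balaban-t4-ne7-p1-g95/WEIGHT-CURRENCY-DEAD.md` — is GONE; suppliers: F326 `decomp_of_directLetters` or any approximate slice fixing).  Original docstring follows.

# Support | NE7 END OF RECORD over `NE7HintOfUhlenbeckChartSU2.hint_SU2` (F324): THE SUP HALF OF ROW NE3's PER-PAIR BINDER DISCHARGED — `hleaves` is replaced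
# by `hleaves♭`, the SLICE NORMALISATION of a GIVEN residual near-representative (the near-representative itself is now a theorem:
# `NE7PairResidualSupRep.pair_residual_sup_rep`, gen 94)

Informal class name: ROW NE7's HINT THEOREM WITH THE PAIR'S RELATIVE SUP DATUM SUPPLIED.

`NE7HintOfUhlenbeckChartSU2.hint_SU2` (gen 93's END of the NE7 record) takes, besides the two numeric lines, ROW NE3's per-pair binder `hleaves`: for every
tangent-critical admissible `U_s` and every admissible `U′` over the same datum, a RESIDUAL SLICE REPRESENTATIVE (`ResidualSliceRepT`: a unitary periodic
corner-trivial gauge `u`, `U′^{u} = U_s·e^{X₀}` with `X₀` in the slice `T_♮(U_s)`, `‖X₀‖ ≤ α₀`) with the weight∕currencies (`α₀M ≤ α̂`, `mM ≤ α̂`, `C ≤ Ĉ`, the local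
quadratic letter).  Gen 94 proves the SUP HALF of this binder for ARBITRARY pairs: `pair_residual_sup_rep` — two unitary `(N·M)`-periodic configurations with plaquettes
`ε∕M²`-close to `1` and the same `(k+1)`-fold average have a unitary `(N·M)`-periodic corner-trivial gauge `u₀` with `‖U_s(b)⁻¹U′^{u₀}(b) − 1‖ ≤ 10³⁴ε∕M` on every bond
([Balaban1985RegularSpaces] Lemma 1 ∕ Thm 2 (1.36)₁ TYPE at a pair; OUR road: cube Landau charts of gen 93's engine, corner consistency from the iterated-average segment
letter, two-party geodesic gluing over the 16 block parities, four period halvings — files F315–F323b).  THIS FILE's END therefore asks only for `hleaves♭`: the SAME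
conclusion as `hleaves`, but from the ADDITIONAL premise of such a near-representative `u₀` — i.e. the slice normalisation (the exact `T_♮(U_s)` condition by a small
residual gauge correction, [Balaban1985RegularSpaces] Sects. D–E TYPE) and the currencies; `ε₀` shrinks to `≤ 1∕(2·10²¹)` so that `pair_residual_sup_rep`'s regime holds
at `card n = 2`.

HONEST LABEL: finite T⁴ rung (B)+1 — NOT infinite volume, NOT mass gap, NOT `BetaPertH`, NOT Clay.  `hleaves♭` and the numeric lines are HYPOTHESES asserted for nothing;
nothing of Bałaban's asserted; NE7 NOT PROVED; spine 0∕9.  No `sorry`; axioms ⊆ {propext, Classical.choice, Quot.sound}.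

Worked on by: prover-b2b-balaban-t4-ne7-p1-g94-0 (lineage b2b-balaban-t4-ne7-p1, gen 94: F324, the END over F314b).
-/

open scoped BigOperators Matrix Matrix.Norms.L2Operator Topology
open NormedSpace Finset Set Filter

namespace Summit.QuantumFields.BalabanUV.T4Continuum.NE7HintOfSliceNormalisationSU2Dec

open Literature.MathematicalPhysics.QuantumFieldTheory.Balaban1983to89
open B7Prop1Explicit B7Prop2Explicit MatrixLog UnitaryModel MatrixNorms
open T4AveragingDeficitWall (Ad IsUnitaryCfg IsSkewDir SmallField vary curl curlSq dirSq dirL1)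
open T4AveragingDeficitWallBoundary (IsPeriodicCfg periodBox)
open AveragingDeficitPeriodicCounting (IsPeriodicDir)
open AveragingDeficitMultiLevelPrep (LevelSmall tower TangentIter cavgIter)
open AveragingDeficitMultiLevelBridge (cavgIter_eq_avgIter)
open BlockAverageVaryHolo (nbRad)
open MinimalActionLevels (perWin)
open MinimalActionSandwich (IsMinimiser admissible)
open MinimalActionRate (sfClass)
open NE3HessForm (dAction)
open NE3SlicePoincareBudgetLine (CPLine)
open NE3TangentCovariantTower (dirIter)
open NE3DecomposedRepOfLinearNormalPart (ResidualSliceRepT)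
open NE3QbarIterCovLiftPrep (cruxC)
open NE3SmoothRightInverseW (rightInvW)
open NE3RightInverseSolveLetters (thetaLoc)
open NE3RightInverseL2Letter (l2C)
open NE3HatInvCurlLetters (curl2C curl1C)
open NE3EnergyShapes (IsUnitarySite IsPeriodicSite)
open NE7HintOfUhlenbeckChartSU2Dec (hint_SU2)
open NE3EnergyWeightedShapes (energyNormW)
open NE3FrameFreeSliceW (frameFreeBlockLandauW)
open NE7PairResidualSupRep (pair_residual_sup_rep)

variable {n : Type} [Fintype n] [DecidableEq n]

/-- **ROW NE7's END OF RECORD OVER THE HONEST BINDER, THE PAIR'S RELATIVE SUP DATUM SUPPLIED** (gen 95: `hleaves♭` ↦ `hdecomp♭`; original description follows): gen 93's `hint_SU2` with ROW NE3's per-pair binder `hleaves` replaced by `hleaves♭` — the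
same slice representative and currencies, but FROM a given residual near-representative `u₀` (unitary, `(N·M)`-periodic, corner-trivial, `‖U_s(b)⁻¹U′^{u₀}(b) − 1‖ ≤
10³⁴ε∕M`), which `NE7PairResidualSupRep.pair_residual_sup_rep` supplies for every admissible pair. [folklore] -/
theorem hint_SU2_of_decomposition [Nonempty n] (hn : Fintype.card n = 2) :
    ∃ ℓ : ℕ, 1 ≤ ℓ ∧ ∃ ε₀ : ℝ, 0 < ε₀ ∧ ∀ ε : ℝ, 0 < ε → ε ≤ ε₀ → ∃ β₀ : ℝ, 0 < β₀ ∧ ∀ β : ℝ, 0 < β → β ≤ β₀ →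
    ∀ (N : ℕ) [NeZero N] (αh νh κh : ℝ), 1 ≤ N →
    -- the k-free ceilings `(α̂, ν̂, κ̂)` of the honest per-pair binder and ONE k-free strict line (F327)
    2 * κh < ((((1 / 2 - νh ^ 2) / (2 * (1 + (CPLine 4 2 2 (1 / 10 ^ 17) (1 / 10 ^ 53) + 1))) - νh ^ 2) / 2 - 576 * ((4 : ℕ) : ℝ) * (αh ^ 2 * Real.exp (2 * αh))) / (Fintype.card n : ℝ) - 28 * ((4 : ℕ) : ℝ) * (ε + 7 * αh ^ 2)) →
    -- THE HONEST PER-PAIR BINDER WITH THE SUP HALF SUPPLIED (`hdecomp♭`: the decomposition + energy letters of a residual near-representative)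
    (∀ D : Site 4 → Fin 4 → (Matrix n n ℂ)ˣ, IsUnitaryCfg D → IsPeriodicCfg D (N : ℤ) → SmallField D (4 * (Real.exp β - 1)) → ∀ (k : ℕ), ∀ Us ∈ admissible (sfClass 4 2 N ε) 2 (k + 1) D, SmallField Us ((1 / ((2 : ℕ) : ℝ) ^ 2 * ε / 2) / (((2 : ℕ) : ℝ) ^ (k + 1)) ^ 2) → (∀ φ : Site 4 → Fin 4 → Matrix n n ℂ, IsSkewDir φ → IsPeriodicDir φ ((N * 2 ^ (k + 1) : ℕ) : ℤ) → TangentIter 2 k Us φ → dAction Us φ (perWin 4 (N * 2 ^ (k + 1))) = 0) → ∀ U' ∈ admissible (sfClass 4 2 N ε) 2 (k + 1) D,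
      -- NEW (gen 94): GIVEN ANY RESIDUAL NEAR-REPRESENTATIVE — a unitary `(N·M)`-periodic corner-trivial gauge in which `U′` is `10³⁴·ε∕M`-close to `U_s` bondwise
      ∀ u₀ : Site 4 → (Matrix n n ℂ)ˣ, IsUnitarySite u₀ → IsPeriodicSite u₀ ((N * 2 ^ (k + 1) : ℕ) : ℤ) → (∀ z : Site 4, u₀ (((2 ^ (k + 1) : ℕ) : ℤ) • z) = 1) →
        (∀ (x : Site 4) (μ : Fin 4), ‖(((Us x μ)⁻¹ * gaugeAct u₀ U' x μ : (Matrix n n ℂ)ˣ) : Matrix n n ℂ) - 1‖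
          ≤ 10000000000000000000000000000000000 * (2 : ℝ) ^ (k + 1) * (ε / (((2 : ℕ) : ℝ) ^ (k + 1)) ^ 2)) →
      ∃ (u : Site 4 → (Matrix n n ℂ)ˣ) (X XT XN : Site 4 → Fin 4 → Matrix n n ℂ) (α ν κ : ℝ),
        IsUnitarySite u ∧ IsSkewDir X ∧ IsPeriodicDir X ((N * 2 ^ (k + 1) : ℕ) : ℤ) ∧ 0 ≤ α ∧ (∀ x μ, ‖X x μ‖ ≤ α) ∧
        gaugeAct u U' = vary Us X 1 ∧
        X = XT + XN ∧ XT ∈ frameFreeBlockLandauW (d := 4) (n := n) 2 N (k + 1) Us ∧ IsSkewDir XN ∧ 0 ≤ ν ∧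
        energyNormW 2 (k + 1) Us XN (periodBox (d := 4) (N * 2 ^ (k + 1)))
          ≤ ν * energyNormW 2 (k + 1) Us X (periodBox (d := 4) (N * 2 ^ (k + 1))) ∧
        ε / (((2 : ℕ) : ℝ) ^ (k + 1)) ^ 2 * (∑ p ∈ perWin 4 (N * 2 ^ (k + 1)), ‖curl Us XN p‖)
          ≤ κ * energyNormW 2 (k + 1) Us X (periodBox (d := 4) (N * 2 ^ (k + 1))) ^ 2 ∧
        α * ((2 : ℕ) : ℝ) ^ (k + 1) ≤ αh ∧ ν ≤ νh ∧ κ ≤ κh) →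
    ∃ δV : ℝ, 0 < δV ∧
      ∀ V ∈ {V : Site 4 → Fin 4 → (Matrix n n ℂ)ˣ | IsUnitaryCfg V ∧ IsPeriodicCfg V (N : ℤ) ∧ SmallField V δV},
      ∀ k : ℕ, ∃ U : Site 4 → Fin 4 → (Matrix n n ℂ)ˣ, IsMinimiser 4 (sfClass 4 2 N ε) 2 N k V U ∧
        ∃ a : ℝ, 0 ≤ a ∧ a < ε / (((2 : ℕ) : ℝ) ^ k) ^ 2 ∧ SmallField U a := by

  obtain ⟨ℓ, hℓ1, ε₀, hε₀, H⟩ := hint_SU2 (n := n) hn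
  refine ⟨ℓ, hℓ1, min ε₀ (1 / 2000000000000000000000), lt_min hε₀ (by norm_num), fun ε hε hεle => ?_⟩
  obtain ⟨β₀, hβ₀, H2⟩ := H ε hε (hεle.trans (min_le_left _ _))
  refine ⟨β₀, hβ₀, fun β hβ hβle N _ αh νh κh hN hline hdecomp => ?_⟩
  have hε21 : ε ≤ 1 / 2000000000000000000000 := hεle.trans (min_le_right _ _)
  refine H2 β hβ hβle N αh νh κh hN hline ?_
  intro D hD hDP hDS k Us hUs hUsS hcrit U' hU'
  -- the pair's relative sup datum from `pair_residual_sup_rep`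
  have hUs' : IsUnitaryCfg Us ∧ IsPeriodicCfg Us ((N * 2 ^ (k + 1) : ℕ) : ℤ) ∧ SmallField Us (ε / (((2 : ℕ) : ℝ) ^ (k + 1)) ^ 2) := hUs.1
  have hU'' : IsUnitaryCfg U' ∧ IsPeriodicCfg U' ((N * 2 ^ (k + 1) : ℕ) : ℤ) ∧ SmallField U' (ε / (((2 : ℕ) : ℝ) ^ (k + 1)) ^ 2) := hU'.1
  have htop : cavgIter 2 (k + 1) U' = cavgIter 2 (k + 1) Us := by
    rw [cavgIter_eq_avgIter, cavgIter_eq_avgIter, hU'.2, hUs.2]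
  have hη : 0 < ε / (((2 : ℕ) : ℝ) ^ (k + 1)) ^ 2 := by positivity
  have hθ : 1000000000000000000000 * (Fintype.card n : ℝ) * (((2 : ℝ) ^ (k + 1)) ^ 2 * (ε / (((2 : ℕ) : ℝ) ^ (k + 1)) ^ 2)) ≤ 1 := by
    have hM0 : (0 : ℝ) < ((2 : ℕ) : ℝ) ^ (k + 1) := by positivity
    have hid : ((2 : ℝ) ^ (k + 1)) ^ 2 * (ε / (((2 : ℕ) : ℝ) ^ (k + 1)) ^ 2) = ε := by
      push_cast at hM0 ⊢; field_simp
    rw [hid, hn]; push_cast; linarith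
  obtain ⟨u₀, hu₀U, hu₀P, hu₀pin, hu₀err⟩ :=
    pair_residual_sup_rep hU''.1 hUs'.1 hN hU''.2.1 hUs'.2.1 hη hU''.2.2 hUs'.2.2 htop hθ
  exact hdecomp D hD hDP hDS k Us hUs hUsS hcrit U' hU' u₀ hu₀U hu₀P hu₀pin hu₀err

end Summit.QuantumFields.BalabanUV.T4Continuum.NE7HintOfSliceNormalisationSU2Dec
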